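import Summits.BirchSwinnertonDyer.BirchSwinnertonDyer.Theorems.AlignedTransportAtTwoMainConjectureOfRankZeroBSDAtTwoTwinValue
import HarnessLib

/-!
# Route `AlignedTransportAtTwo`, crux C2 `MainConjectureOfRankZeroBSDAtTwo` (stmt-BirchSwinnertonDyer-22298):
# THE `λ`-PARITY AT `p = 2` — an `ι`-stable `F ∈ ℤ₂⟦T⟧` vanishing at NEITHER `ι`-fixed point `T = 0`, `T = −2` has EVEN `λ(F)`;
# for `X(W/ℚ_∞)`: Greenberg's Prop. 3.10 parity in its missing case `p = 2` (twin form), and the twin-value door's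
# conclusion upgraded to `μ = 0 ∧ λ even ∧ 2 ≤ λ`

HONEST FRAMING (cell `bsd-f1-sign2`, WIDTH-5 attached prover seat `bsd-line-att-p5` gen 49 on line `birth` of the lead
`bsd-line-att-p2`; `--supports` stmt-BirchSwinnertonDyer-22298, closes nothing; BSD is NOT proved by any of this; the crux
C2, its verdict «blocked-on `Rank1Residual.GreenbergMuConjectureIrreducible`» and every registered stub are untouched).
THEOREMS ONLY — no `def`, no instance, no named fact, no `sorry`. PRINT binder `h114` = Greenberg Thm. 1.14 (tree named fact
`Greenberg1999_thm114_charIdeal_iota_invariant`); Greenberg's Thm. 4.1 is the kernel theorem. Sequel of `…TwinValueAlgebra` /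
`…TwinValueDichotomy` / `…TwinValue` (att-p5 g49).

THE POINT. Greenberg, LNM 1716, Prop. 3.10 («`corank Sel_E(F)_p ≡ λ_E (mod 2)`») is printed for `p` ODD (tree fact
`prop310_selmerCorank_mod_two_eq_lambdaInvariant`, binder `p ≠ 2`): at `p = 2` the non-trivial `ℚ₂`-irreducible representation of
`ℤ/2` has ODD degree `1` — the first layer `ℚ_1 = ℚ(√2)` — so the printed congruence must be read against `Sel_E(ℚ(√2))`, not
`Sel_E(ℚ)`. In the tree's `Λ`-currency this is exactly the exclusion of BOTH `ι`-fixed linear primes `(T)` and `(T + 2)`: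

* §1 (algebra) `comap_invol_span_singleton` (`ι⁻¹(F) = (ιF)`), `lam_invol` (**`λ(ιF) = λ(F)`**), ★★ `even_lam_of_iotaStable`:
  for non-zero `F ∈ ℤ₂⟦T⟧` with `ι`-stable ideal, **`F(0) ≠ 0 ∧ F(−2) ≠ 0 ⟹ λ(F)` even** (induction over the UFD factorisation as in
  the dichotomy: `λ(2) = 0`, an `ι`-moved pair weighs `2λ(π)`, an `ι`-fixed prime `∌ T, T+2` has even `λ` by the tree's parity
  theorem `even_lambdaInvariant_quotient_of_comap_invol_eq_of_X_add_C_two_notMem`).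
* §2 (datum) ★★ `even_lambda_of_twin_ne_zero`: `W/ℚ` globally minimal, good ordinary at `2`, `Sel_{2^∞}(W/ℚ)` finite, `(κ, γ)` the
  normalised cyclotomic datum, `D` any dual datum, a generator `f_X` of `char_Λ X` with **`f_X(−2) ≠ 0`** (the displayed «no zero at
  the conductor-`8` character», i.e. `Sel_{2^∞}(W/ℚ(√2))` finite in Greenberg's reading), PRINT `h114` ⟹ **`λ(X(W/ℚ_∞))` is EVEN** —
  Prop. 3.10's parity in the missing case `p = 2`, modulo the twin non-vanishing; ★★★ `mu_eq_zero_and_even_lambda_of_twinValue`: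
  under the twin-value door's hypotheses (`{e(W), ord₂ f_X(−2)} ∋ 2`, distinct) **`μ(X) = 0`, `λ(X)` even and `2 ≤ λ(X)`**
  (so `λ(X) = 2` as soon as `λ(X) ≤ 3`, e.g. by Kato's divisibility against an analytic `λ₂ ≤ 3`; the case `λ ≥ 4` is a single `ι`-fixed
  prime of degree `≥ 4`, excluded only by a Newton-polygon argument not run here).

References: R. Greenberg, LNM 1716 (1999), Prop. 3.10 (p. 98), Thm. 1.14 (p. 68), Thm. 4.1 (p. 102) [GreenbergLNM1716]; B. Mazur,
J. Tate, J. Teitelbaum, Invent. Math. 84 (1986) Ch. I §17 [MazurTateTeitelbaum1986Invent]; L. Washington, GTM 83, §7.1, §13.2 [Washington1997].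
-/

set_option linter.dupNamespace false
set_option autoImplicit false

noncomputable section

open scoped Classical

namespace Summit.BirchSwinnertonDyer.BirchSwinnertonDyer.Theorems.AlignedTransportAtTwoTwinValueParity

open PowerSeries WeierstrassCurve Literature.NumberTheory.EllipticCurves Literature.NumberTheory.EllipticCurves.IwasawaAlgebra
  Literature.NumberTheory.EllipticCurves.Greenberg1999
  Summit.BirchSwinnertonDyer.Rank1Residual.X1.MuLambda Summit.BirchSwinnertonDyer.Rank1Residual.X1.ParitySqueeze
  Summit.BirchSwinnertonDyer.Rank1Residual.Supersingular Summit.BirchSwinnertonDyer.Rank1Residual.Supersingular.BlindLever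
  Summit.BirchSwinnertonDyer.BirchSwinnertonDyer.Theorems
  Summit.BirchSwinnertonDyer.BirchSwinnertonDyer.Theorems.AlignedTransportAtTwoTwinValueAlgebra
  Summit.BirchSwinnertonDyer.BirchSwinnertonDyer.Theorems.AlignedTransportAtTwoTwinValue
  Summit.BirchSwinnertonDyer.BirchSwinnertonDyer.Theorems.AlignedTransportAtTwoTwistSaturation
  Summit.BirchSwinnertonDyer.BirchSwinnertonDyer.Theorems.AlignedTransportAtTwoCyclotomicLayerWeightEuler
  Summit.BirchSwinnertonDyer.BirchSwinnertonDyer.Theorems.TwoAdicEulerCharKernel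

/-! ## §1 `λ` is `ι`-invariant; the parity of `λ` for `ι`-stable series off both fixed points -/

section Algebra

/-- **`ι⁻¹(F) = (ιF)`** as ideals of `Λ` (`ι` is an involutive ring automorphism). [cite: MazurTateTeitelbaum1986Invent, Ch. I §17] -/
theorem comap_invol_span_singleton (F : IwasawaAlgebra 2) :
    (Ideal.span {F}).comap (invol 2).toRingHom = Ideal.span {invol 2 F} := by
  ext f
  rw [Ideal.mem_comap, Ideal.mem_span_singleton, Ideal.mem_span_singleton]
  change F ∣ invol 2 f ↔ invol 2 F ∣ f
  constructor
  · intro h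
    have h' := map_dvd (invol 2) h
    rwa [invol_invol] at h'
  · intro h
    have h' := map_dvd (invol 2) h
    rwa [invol_invol] at h'

/-- **`λ(ιF) = λ(F)`** for `F ≠ 0` (`Λ/(ιF) = Λ/ι⁻¹(F)` has the `λ` of `Λ/(F)`, tree `lambdaInvariant_quotient_comap_invol_eq`;
`λ(Λ/(F)) = λ(F)`, tree `lam_generator_eq_lambdaInvariant`). [cite: GreenbergLNM1716, §1 (p. 60)] [cite: Washington1997, §13.2] -/
theorem lam_invol {F : IwasawaAlgebra 2} (hF : F ≠ 0) : lam (invol 2 F) = lam F := by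
  have hιF : invol 2 F ≠ 0 := fun h ↦ hF (by rw [← invol_invol 2 F, h, map_zero])
  have hb : lam F = lambdaInvariant 2 (IwasawaAlgebra 2 ⧸ Ideal.span {F}) :=
    lam_generator_eq_lambdaInvariant (IwasawaAlgebra 2 ⧸ Ideal.span {F}) (isTorsion_quotient_span_singleton' hF) hF
      (Literature.NumberTheory.EllipticCurves.Module.charIdeal_quotient_span_singleton hF)
  have hb' : lam (invol 2 F) = lambdaInvariant 2 (IwasawaAlgebra 2 ⧸ Ideal.span {invol 2 F}) :=
    lam_generator_eq_lambdaInvariant (IwasawaAlgebra 2 ⧸ Ideal.span {invol 2 F}) (isTorsion_quotient_span_singleton' hιF) hιF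
      (Literature.NumberTheory.EllipticCurves.Module.charIdeal_quotient_span_singleton hιF)
  rw [hb, hb', ← comap_invol_span_singleton F]
  exact lambdaInvariant_quotient_comap_invol_eq (Ideal.span {F})

/-- ★★ **THE `λ`-PARITY at `p = 2`.** For non-zero `F ∈ ℤ₂⟦T⟧` with `ι`-stable ideal (`ιF = u·F`) vanishing at NEITHER `ι`-fixed
point (`F(0) ≠ 0`, `F(−2) ≠ 0`): **`λ(F)` is even.** (Induction on `ord₂ F(0)` over the prime factorisation: `λ(2) = 0`; an `ι`-moved
prime `π` pairs with `ιπ ∣ F`, weight `2λ(π)`; an `ι`-fixed prime `∌ T, T+2` has even `λ`.) [cite: GreenbergLNM1716, Prop. 3.10 (p. 98) and Thm. 1.14]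
[cite: MazurTateTeitelbaum1986Invent, Ch. I §17] [cite: Washington1997, §7.1, §13.2] -/
theorem even_lam_of_iotaStable : ∀ (n : ℕ) (F : IwasawaAlgebra 2), F ≠ 0 → (constantCoeff F).valuation ≤ n →
    (∃ u : (IwasawaAlgebra 2)ˣ, invol 2 F = u * F) → constantCoeff F ≠ 0 → evalAt (-2 : ℤ_[2]) F ≠ 0 → Even (lam F) := by
  intro n
  induction n with
  | zero =>
    intro F hF0 hle _ h0 _
    have hu0 : IsUnit (constantCoeff F) := by
      by_contra hnu
      have := one_le_valuation_of_not_isUnit h0 hnu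
      omega
    rw [lam_eq_zero_of_isUnit (isUnit_iff_constantCoeff.mpr hu0)]
    exact Even.zero
  | succ n ih =>
    intro F hF0 hle hι h0 h2
    by_cases hFu : IsUnit F
    · rw [lam_eq_zero_of_isUnit hFu]; exact Even.zero
    obtain ⟨π, hπirr, hπF⟩ := WfDvdMonoid.exists_irreducible_factor hFu hF0
    have hπ : Prime π := hπirr.prime
    have hπ0 : π ≠ 0 := hπ.ne_zero
    obtain ⟨G, hFG⟩ := hπF
    have hG0 : G ≠ 0 := fun h ↦ hF0 (by rw [hFG, h, mul_zero])
    have hcc : constantCoeff F = constantCoeff π * constantCoeff G := by rw [hFG, map_mul]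
    have hev : evalAt (-2 : ℤ_[2]) F = evalAt (-2 : ℤ_[2]) π * evalAt (-2 : ℤ_[2]) G := by
      rw [hFG, evalAt_mul norm_neg_two_lt_one]
    have hπc0 : constantCoeff π ≠ 0 := fun h ↦ h0 (by rw [hcc, h, zero_mul])
    have hGc0 : constantCoeff G ≠ 0 := fun h ↦ h0 (by rw [hcc, h, mul_zero])
    have hπe0 : evalAt (-2 : ℤ_[2]) π ≠ 0 := fun h ↦ h2 (by rw [hev, h, zero_mul])
    have hGe0 : evalAt (-2 : ℤ_[2]) G ≠ 0 := fun h ↦ h2 (by rw [hev, h, mul_zero])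
    have haF : (constantCoeff F).valuation = (constantCoeff π).valuation + (constantCoeff G).valuation := by
      rw [hcc, PadicInt.valuation_mul hπc0 hGc0]
    have haπ : 1 ≤ (constantCoeff π).valuation := one_le_valuation_constantCoeff_of_not_isUnit hπirr.not_isUnit hπc0
    have hlamF : lam F = lam π + lam G := by rw [hFG, lam_mul hπ0 hG0]
    have hπX : ¬ π ∣ PowerSeries.X := by
      intro h
      have hassoc : Associated π (PowerSeries.X : IwasawaAlgebra 2) := hπirr.associated_of_dvd X_prime.irreducible h
      exact h0 (X_dvd_iff.mp (hassoc.symm.dvd.trans ⟨G, hFG⟩))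
    have hπX2 : ¬ π ∣ (PowerSeries.X + PowerSeries.C (2 : ℤ_[2])) := by
      intro h
      have hassoc : Associated π (PowerSeries.X + PowerSeries.C (2 : ℤ_[2]) : IwasawaAlgebra 2) :=
        hπirr.associated_of_dvd prime_X_add_C_two.irreducible h
      obtain ⟨H, hH⟩ := hassoc.symm.dvd.trans ⟨G, hFG⟩
      apply h2
      rw [hH, evalAt_mul norm_neg_two_lt_one, evalAt_neg_two_X_add_C_two, zero_mul]
    by_cases h2F : (PowerSeries.C (2 : ℤ_[2]) : IwasawaAlgebra 2) ∣ F
    · -- `F = 2 G'`: `λ(2) = 0`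
      clear hcc hev hπc0 hGc0 hπe0 hGe0 haF haπ hlamF hπX hπX2 hFG hG0 G hπ0 hπ hπirr π
      obtain ⟨G, hFG⟩ := h2F
      have hG0 : G ≠ 0 := fun h ↦ hF0 (by rw [hFG, h, mul_zero])
      have hcc : constantCoeff F = 2 * constantCoeff G := by rw [hFG, map_mul, constantCoeff_C]
      have hev : evalAt (-2 : ℤ_[2]) F = 2 * evalAt (-2 : ℤ_[2]) G := by rw [hFG, evalAt_mul norm_neg_two_lt_one, evalAt_C]
      have hGc0 : constantCoeff G ≠ 0 := fun h ↦ h0 (by rw [hcc, h, mul_zero])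
      have hGe0 : evalAt (-2 : ℤ_[2]) G ≠ 0 := fun h ↦ h2 (by rw [hev, h, mul_zero])
      have haF : (constantCoeff F).valuation = 1 + (constantCoeff G).valuation := by rw [hcc, valuation_two_mul hGc0]
      have hιG : ∃ u : (IwasawaAlgebra 2)ˣ, invol 2 G = u * G :=
        iotaStable_of_mul_left hι hFG prime_C_two.ne_zero ⟨1, by rw [invol_C, Units.val_one, one_mul]⟩
      have hlam2 : lam (PowerSeries.C (2 : ℤ_[2]) : IwasawaAlgebra 2) = 0 := by
        have h := lam_C_pow (p := 2) 1
        rwa [pow_one, Nat.cast_ofNat] at h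
      rw [hFG, lam_mul prime_C_two.ne_zero hG0, hlam2, zero_add]
      exact ih G hG0 (by omega) hιG hGc0 hGe0
    have hπ2 : ¬ Associated π (PowerSeries.C (2 : ℤ_[2])) := fun h ↦ h2F (h.symm.dvd.trans ⟨G, hFG⟩)
    by_cases hfix : Associated (invol 2 π) π
    · -- `ι`-fixed prime: even `λ(π)`, recurse on the `ι`-stable cofactor
      have heven := even_lam_of_fixed_prime hπ hfix hπX hπX2
      have hιG : ∃ u : (IwasawaAlgebra 2)ˣ, invol 2 G = u * G := by
        obtain ⟨w, hw⟩ := hfix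
        refine iotaStable_of_mul_left hι hFG hπ0 ⟨w⁻¹, ?_⟩
        rw [(Units.eq_mul_inv_iff_mul_eq w).mpr hw, mul_comm]
      have hG := ih G hG0 (by omega) hιG hGc0 hGe0
      rw [hlamF]
      exact heven.add hG
    · -- `ι`-moved prime: `π · ιπ ∣ F`, weight `2λ(π)`, recurse on the `ι`-stable cofactor
      have hιπ : Prime (invol 2 π) := prime_invol hπ
      have hιπF : invol 2 π ∣ F := invol_dvd_of_dvd hι ⟨G, hFG⟩
      have hιπG : invol 2 π ∣ G := by
        rw [hFG] at hιπF
        rcases hιπ.dvd_or_dvd hιπF with h | h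
        · exact absurd (hιπ.irreducible.associated_of_dvd hπirr h) hfix
        · exact h
      obtain ⟨H, hGH⟩ := hιπG
      have hH0 : H ≠ 0 := fun h ↦ hG0 (by rw [hGH, h, mul_zero])
      have hιπ0 : invol 2 π ≠ 0 := hιπ.ne_zero
      have hccG : constantCoeff G = constantCoeff (invol 2 π) * constantCoeff H := by rw [hGH, map_mul]
      have hevG : evalAt (-2 : ℤ_[2]) G = evalAt (-2 : ℤ_[2]) (invol 2 π) * evalAt (-2 : ℤ_[2]) H := by
        rw [hGH, evalAt_mul norm_neg_two_lt_one]
      have hHc0 : constantCoeff H ≠ 0 := fun h ↦ hGc0 (by rw [hccG, h, mul_zero])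
      have hHe0 : evalAt (-2 : ℤ_[2]) H ≠ 0 := fun h ↦ hGe0 (by rw [hevG, h, mul_zero])
      have haG : (constantCoeff G).valuation = (constantCoeff π).valuation + (constantCoeff H).valuation := by
        rw [hccG, constantCoeff_invol 2 π, PadicInt.valuation_mul hπc0 hHc0]
      -- `(H)` is `ι`-stable: `F = (π·ιπ)·H` with `π·ιπ` `ι`-invariant
      have hFPH : F = (π * invol 2 π) * H := by rw [hFG, hGH, mul_assoc]
      have hιH : ∃ u : (IwasawaAlgebra 2)ˣ, invol 2 H = u * H :=
        iotaStable_of_mul_left hι hFPH (mul_ne_zero hπ0 hιπ0) ⟨1, by rw [invol_mul_invol_self, Units.val_one, one_mul]⟩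
      have hH := ih H hH0 (by omega) hιH hHc0 hHe0
      rw [hlamF, hGH, lam_mul hιπ0 hH0, lam_invol hπ0, ← add_assoc, ← two_mul]
      exact (even_two_mul _).add hH

/-- ★★ **`λ`-parity, headline**: `F ≠ 0` in `ℤ₂⟦T⟧` with `ι`-stable ideal, `F(0) ≠ 0`, `F(−2) ≠ 0` ⟹ `Even (λ F)`.
[cite: GreenbergLNM1716, Prop. 3.10 (p. 98) and Thm. 1.14] [cite: MazurTateTeitelbaum1986Invent, Ch. I §17] -/
theorem even_lam_of_iotaStable' {F : IwasawaAlgebra 2} (hF0 : F ≠ 0) (hι : ∃ u : (IwasawaAlgebra 2)ˣ, invol 2 F = u * F)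
    (h0 : constantCoeff F ≠ 0) (h2 : evalAt (-2 : ℤ_[2]) F ≠ 0) : Even (lam F) :=
  even_lam_of_iotaStable _ F hF0 le_rfl hι h0 h2

end Algebra

/-! ## §2 Datum level: Prop. 3.10's parity at `p = 2` (twin form); the door's conclusion with `λ` -/

section Datum

variable (κ : ZpExtension ℚ 2) (hκ : κ.IsCyclotomic) {γ : Field.absoluteGaloisGroup ℚ} (hγ : κ.IsTopGenerator γ)
  (hγ' : IsCyclotomicVariable 2 γ) (W : WeierstrassCurve ℚ) [W.IsElliptic] [W.IsGloballyMinimal]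

include hκ hγ hγ' in
/-- ★★ **GREENBERG'S PARITY (Prop. 3.10) IN ITS MISSING CASE `p = 2`, twin form.** `W/ℚ` globally minimal, good ordinary at `2`,
`Sel_{2^∞}(W/ℚ)` finite; `(κ, γ)` the normalised cyclotomic datum, `D` any dual datum of `Sel_{2^∞}(W/ℚ_∞)`, `f_X` a generator of
`char_Λ X` with `f_X(−2) ≠ 0` (no zero at the character of `ℚ(√2)`); `#W(ℚ)[2^∞] = 2^t`, `#Ẽ(𝔽₂)[2^∞] = 2^e`, `#Sel_{2^∞}(W/ℚ) = 2^s`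
(data, only used to read `f_X(0) ≠ 0` off Greenberg's Thm. 4.1, kernel); PRINT `h114` (Thm. 1.14). Then **`λ(X(W/ℚ_∞))` is EVEN**.
(At odd `p` the printed Prop. 3.10 needs only `Sel_E(ℚ)` finite; at `p = 2` the second `ι`-fixed point `T = −2` must be excluded as well.)
[cite: GreenbergLNM1716, Prop. 3.10 (p. 98), Thm. 1.14 (p. 68), Thm. 4.1 (p. 102)] [cite: MazurTateTeitelbaum1986Invent, Ch. I §17] -/
theorem even_lambda_of_twin_ne_zero (h114 : Greenberg1999_thm114_charIdeal_iota_invariant) (hord : IsOrdinaryAt W 2)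
    (D : W.SelmerDualData κ γ) (hfin : Finite (W.selmerGroupPInfty 2)) {t e s : ℕ}
    (ht : Nat.card (AddCommGroup.primaryComponent W.toAffine.Point 2) = 2 ^ t)
    (he : Nat.card (AddCommGroup.primaryComponent ((integralModelInt W).map (Int.castRingHom (ZMod 2))).toAffine.Point 2) = 2 ^ e)
    (hs : Nat.card (W.selmerGroupPInfty 2) = 2 ^ s) {fX : IwasawaAlgebra 2}
    (hchar : D.charIdeal = Ideal.span {fX}) (h2 : evalAt (-2 : ℤ_[2]) fX ≠ 0) : Even D.lambda := by
  haveI : Module.Finite (IwasawaAlgebra 2) D.X := D.module_finite_holds hγ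
  have hD : D.IsTorsion := isTorsion_of_finite κ hκ hγ W hord D hfin
  obtain ⟨-, hnorm⟩ := norm_constantCoeff_charGen_eq_of_thm41 W thm41_charValue_rankZero_anyPrime_holds
    ((isOrdinaryAt_iff W 2).mp hord).1 ((isOrdinaryAt_iff W 2).mp hord).2 hκ hγ hγ' D hD hchar hfin ht he hs
  obtain ⟨hc0, -⟩ := valuation_eq_of_norm_eq_two_inv_pow hnorm
  have hfXne : fX ≠ 0 := fun h0 ↦ hc0 (by rw [h0, map_zero])
  have hι := iotaStable_charGen_of_thm114 h114 W hord hκ hγ D hD hchar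
  have h := even_lam_of_iotaStable' hfXne hι hc0 h2
  rwa [lam_generator_eq_lambdaInvariant D.X hD hfXne hchar] at h

include hκ hγ hγ' in
/-- ★★★ **THE TWIN-VALUE DOOR WITH `λ`, datum level.** Hypotheses of `…TwinValue.mu_eq_zero_of_twinValue` (Euler weight
`w = ord₂ ∏c_ℓ + 2e + s − 2t`, twin value `ord₂ f_X(−2)` with `f_X(−2) ≠ 0`, `{w, ord₂ f_X(−2)} ∋ 2` and the two distinct; PRINT `h114`):
**`μ(X(W/ℚ_∞)) = 0`, `λ(X(W/ℚ_∞))` is even, and `2 ≤ λ(X(W/ℚ_∞))`** (the characteristic series is `2`-free, of even Weierstrass degree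
`≥ 2`: a pair of `ι`-mirror zeros, or one `ι`-fixed prime of even degree). [cite: GreenbergLNM1716, Prop. 3.10 (p. 98), Thm. 1.14 (p. 68), Thm. 4.1 (p. 102)]
[cite: MazurTateTeitelbaum1986Invent, Ch. I §17] [cite: Washington1997, §7.1] -/
theorem mu_eq_zero_and_even_lambda_of_twinValue (h114 : Greenberg1999_thm114_charIdeal_iota_invariant) (hord : IsOrdinaryAt W 2)
    (D : W.SelmerDualData κ γ) (hfin : Finite (W.selmerGroupPInfty 2)) {t e s : ℕ}
    (ht : Nat.card (AddCommGroup.primaryComponent W.toAffine.Point 2) = 2 ^ t)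
    (he : Nat.card (AddCommGroup.primaryComponent ((integralModelInt W).map (Int.castRingHom (ZMod 2))).toAffine.Point 2) = 2 ^ e)
    (hs : Nat.card (W.selmerGroupPInfty 2) = 2 ^ s) {fX : IwasawaAlgebra 2} (hchar : D.charIdeal = Ideal.span {fX})
    (h2 : evalAt (-2 : ℤ_[2]) fX ≠ 0)
    (htwo : padicValNat 2 W.tamagawaProduct + 2 * e + s - 2 * t = 2 ∨ (evalAt (-2 : ℤ_[2]) fX).valuation = 2)
    (hne : padicValNat 2 W.tamagawaProduct + 2 * e + s - 2 * t ≠ (evalAt (-2 : ℤ_[2]) fX).valuation) :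
    D.mu = 0 ∧ Even D.lambda ∧ 2 ≤ D.lambda := by
  have hμ := mu_eq_zero_of_twinValue κ hκ hγ hγ' W h114 hord D hfin ht he hs hchar h2 htwo hne
  have heven := even_lambda_of_twin_ne_zero κ hκ hγ hγ' W h114 hord D hfin ht he hs hchar h2
  refine ⟨hμ, heven, ?_⟩
  -- `λ ≠ 0`: the generator is not a unit (one of its two values has `2`-adic order `2`)
  haveI : Module.Finite (IwasawaAlgebra 2) D.X := D.module_finite_holds hγ
  have hD : D.IsTorsion := isTorsion_of_finite κ hκ hγ W hord D hfin
  obtain ⟨-, hnorm⟩ := norm_constantCoeff_charGen_eq_of_thm41 W thm41_charValue_rankZero_anyPrime_holds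
    ((isOrdinaryAt_iff W 2).mp hord).1 ((isOrdinaryAt_iff W 2).mp hord).2 hκ hγ hγ' D hD hchar hfin ht he hs
  obtain ⟨hc0, hval⟩ := valuation_eq_of_norm_eq_two_inv_pow hnorm
  have hfXne : fX ≠ 0 := fun h0 ↦ hc0 (by rw [h0, map_zero])
  have hlamfX : lam fX = D.lambda := lam_generator_eq_lambdaInvariant D.X hD hfXne hchar
  have hnu : ¬ IsUnit fX := by
    intro hu
    rcases htwo with hw | hb
    · -- `ord₂ f_X(0) = w = 2`, but a unit has unit constant term
      have h1 : (constantCoeff fX).valuation = 0 := by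
        have hcu : IsUnit (constantCoeff fX) := isUnit_iff_constantCoeff.mp hu
        have hn : ‖constantCoeff fX‖ = 1 := PadicInt.isUnit_iff.mp hcu
        have := PadicInt.norm_eq_zpow_neg_valuation hc0
        rw [hn] at this
        have h3 : (2 : ℝ) ^ (-((constantCoeff fX).valuation : ℤ)) = (2 : ℝ) ^ (0 : ℤ) := by
          rw [zpow_zero]; exact_mod_cast this.symm
        have := zpow_right_injective₀ (by norm_num) (by norm_num) h3
        omega
      omega
    · have heu : IsUnit (evalAt (-2 : ℤ_[2]) fX) := (isUnit_evalAt_iff norm_neg_two_lt_one fX).mpr hu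
      have h1 : (evalAt (-2 : ℤ_[2]) fX).valuation = 0 := by
        have hn : ‖evalAt (-2 : ℤ_[2]) fX‖ = 1 := PadicInt.isUnit_iff.mp heu
        have := PadicInt.norm_eq_zpow_neg_valuation h2
        rw [hn] at this
        have h3 : (2 : ℝ) ^ (-((evalAt (-2 : ℤ_[2]) fX).valuation : ℤ)) = (2 : ℝ) ^ (0 : ℤ) := by
          rw [zpow_zero]; exact_mod_cast this.symm
        have := zpow_right_injective₀ (by norm_num) (by norm_num) h3
        omega
      omega
  have hlam0 : lam fX ≠ 0 := by
    intro h0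
    have hμfX : mu fX = 0 := by
      rw [Summit.BirchSwinnertonDyer.Rank1Residual.X1.MuPart.mu_generator_eq_muInvariant D.X hD hfXne hchar]; exact hμ
    exact hnu ((isUnit_iff_mu_eq_zero_and_lam_eq_zero fX).mpr ⟨hfXne, hμfX, h0⟩)
  rw [← hlamfX]
  rw [← hlamfX] at heven
  obtain ⟨k, hk⟩ := heven
  omega

end Datum

end Summit.BirchSwinnertonDyer.BirchSwinnertonDyer.Theorems.AlignedTransportAtTwoTwinValueParity

end
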